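import Literature.NumberTheory.DiophantineGeometry.AbelianSchemeModelReduction
import Literature.NumberTheory.GaloisRepresentations.AbsIntegersValuationSubringFrobenius
import Literature.NumberTheory.GaloisRepresentations.IntegralGaloisActionProofs
import Mathlib.RingTheory.Valuation.LocalSubring
import Mathlib.FieldTheory.IsAlgClosed.Basic
import HarnessLib

/-!
# A local domain algebraic over `𝓞_{K,v}` maps locally into the valuation ring `R` of `\overline{K_v}`
# (places of a finite extension above `v` come from `K`-embeddings into `\overline{K_v}`; [NeukirchANT1999] II (8.1), [Liu2002] 10.1.38)

Topic `Literature/NumberTheory/GaloisRepresentations`; namespace `Literature.NumberTheory.GaloisRepresentations`.  PROOF FILE (one theorem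
+ two lemmas; no definition, no named fact, no instance, no `sorry`).  Cell `hodgecm-mathlib` (D-0151), FLOOR-0 P5a, D9op road 2′, ED4 cut
of `Cruxes/HLiu418/Lines/F0_D9opRoad2.lean`, letter `stub_H` in its consumed form «the reduction map `red_𝒳 : X(\overline{K_v}) → 𝒳_v(κ̄)` of a
proper flat model is surjective onto closed points» (road (b)): this is piece **(b2)**, the «place-from-embedding» step.  Piece (b1)
(`Literature/RingTheory/Flat/SpecialFibreClosedPointGenerization.lean`) produces, for a closed point `x̃` of the special fibre, a prime
`q ∌ ϖ` of `O = 𝒪_{𝒳,x̃}` with `O/q` a LOCAL DOMAIN ALGEBRAIC over `𝓞_{K,v}` whose maximal ideal lies over `v`; the present file maps any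
such local domain `D` into `R = closureValuationSubring K_v ⊆ Ω = \overline{K_v}` by a LOCAL homomorphism over `𝓞_{K,v}` — i.e. it produces
the `R`-point of `𝒳` through `x̃` (`Spec R → Spec D = \overline{{x}} ⊆ 𝒳`, closed point ↦ `x̃`); piece (b3) reads it in ★ `IntegralModel.geomReductionMap`.

THE MATHEMATICS ([NeukirchANT1999] Ch. II (8.1): the primes of `K̄` above `v` are the `ι⁻¹(𝔪_R)` for the `K`-embeddings `ι : K̄ → \overline{K_v}`;
[Liu2002] §10.1.3 proof of Lemma 10.1.32 / Cor. 10.1.38: «`𝒪_{K̄}` is a local ring that dominates `𝒪_{Z,x̃}`»).  Given `D`: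
(1) `ψ : D → K̄` over `𝓞_{K,v}` (Mathlib `IsAlgClosed.lift`, `D` algebraic); (2) Chevalley: a valuation ring `V` of `K̄` DOMINATING `ψ(D)`
(Mathlib `IsLocalRing.exists_factor_valuationRing`); its centre `𝔓 = 𝔪_V ∩ ℤ̄` is a prime of `ℤ̄` above `v` (`𝔪_D` lies over `v`), so
`V = ℤ̄_𝔓` (★ `eq_absIntegersValuationSubring_of_absIntegersCentre_eq`); (3) `Γ_K` is transitive on the primes above `v`
(★ `exists_smul_eq_of_mem_primesAbove_holds`): `γ • 𝔓 = 𝔓₀ = adicCompletionPrime K v`, the prime cut out by the tree's embedding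
`ι = absClosureEmbedding K K_v`, whence `γ • V = ℤ̄_{𝔓₀} = ι⁻¹(R)` (★ `comap_closureValuationSubring_adicCompletion`) and `ι|_{ℤ̄_{𝔓₀}}` is
local (★ `isLocalHom_restrict_absClosureEmbedding_adicCompletion`); (4) `f = ι ∘ γ ∘ ψ : D → R` is a local homomorphism with
`f|_{𝓞_{K,v}} = (𝓞_{K,v} → R)` (★ `toClosureValuationSubring`).

* `smul_mem_nonunits_pointwise_smul_iff` — bookkeeping: `γ • y` is a non-unit of `γ • V` iff `y` is a non-unit of `V`;
* `ne_top_of_mem_nonunits` — bookkeeping: a valuation ring of `K̄` with a non-zero non-unit is not `K̄`;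
* **`exists_isLocalHom_comp_algebraMap_eq_toClosureValuationSubring`** — the theorem.

HC_CM is proved only modulo the 7 printed citations until rung 0 closes; nothing of [Liu2021] is asserted here.

## References
* [NeukirchANT1999] J. Neukirch, *Algebraic Number Theory* (1999), Ch. II §8, (8.1)–(8.2) (extensions of valuations ↔ embeddings into `\overline{K_v}`),
  Ch. I §9 Prop. (9.1) (transitivity of the Galois group on primes).
* [Liu2002] Q. Liu, *Algebraic Geometry and Arithmetic Curves* (2002), §10.1.3, Lemma 10.1.32 and Cor. 10.1.38 (reduction map via a
  valuation ring of `K̄` dominating `𝒪_{Z,x̃}`).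
* [StacksProject] Tag 00IA (Chevalley: local rings are dominated by valuation rings).
-/

set_option autoImplicit false

noncomputable section

universe u

open IsDedekindDomain IsDedekindDomain.HeightOneSpectrum NumberField Field IsLocalRing
open Literature.NumberTheory.DiophantineGeometry
open scoped Pointwise

namespace Literature.NumberTheory.GaloisRepresentations

-- as in `AbsIntegersLocalization`: the pointwise `G_K`-actions on `ℤ̄` and on its ideals are found slowly
set_option synthInstance.maxHeartbeats 160000

section Bookkeeping

variable {K : Type u} [Field K]

/-- Transport of non-units along the Galois action on valuation rings of `K̄`: `γ • y` is a non-unit of `γ • V` iff `y` is a non-unit of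
`V` (`y ∈ V.nonunits ↔ y = 0 ∨ y⁻¹ ∉ V`, and `(γ • y)⁻¹ = γ • y⁻¹`). [cite: NeukirchANT1999, Ch. II §9 (9.1)] -/
theorem smul_mem_nonunits_pointwise_smul_iff (γ : absoluteGaloisGroup K) (V : ValuationSubring (AlgebraicClosure K))
    (y : AlgebraicClosure K) : γ • y ∈ (γ • V).nonunits ↔ y ∈ V.nonunits := by
  rw [ValuationSubring.mem_nonunits_iff_or, ValuationSubring.mem_nonunits_iff_or, smul_eq_zero_iff_eq, ← smul_inv'',
    ValuationSubring.smul_mem_pointwise_smul_iff]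

/-- A valuation ring `V` of `K̄` having a NON-ZERO element among its non-units is not all of `K̄`.
[cite: NeukirchANT1999, Ch. II §8 (8.1)] -/
theorem ne_top_of_mem_nonunits (V : ValuationSubring (AlgebraicClosure K)) {y : AlgebraicClosure K}
    (hy0 : y ≠ 0) (hy : y ∈ V.nonunits) : V ≠ ⊤ := by
  rintro rfl
  rw [ValuationSubring.mem_nonunits_iff_or] at hy
  rcases hy with h | h
  · exact hy0 h
  · exact h (ValuationSubring.mem_top _)

end Bookkeeping

section Main

variable {K : Type} [Field K] [NumberField K] (v : HeightOneSpectrum (𝓞 K))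
  {D : Type u} [CommRing D] [IsDomain D] [IsLocalRing D] [Algebra (valuationSubringAtPrime K v) D]
  [FaithfulSMul (valuationSubringAtPrime K v) D] [Algebra.IsAlgebraic (valuationSubringAtPrime K v) D]
  [IsLocalHom (algebraMap (valuationSubringAtPrime K v) D)]

/-- **Places above `v` come from embeddings into `\overline{K_v}` — local-ring form.**  Let `K` be a number field, `v` a finite place,
`𝓞_{K,v} = valuationSubringAtPrime K v`, `R = closureValuationSubring K_v ⊆ Ω = \overline{K_v}` the valuation ring of `\overline{K_v}`.  Let `D` be a
LOCAL DOMAIN which is an algebra over `𝓞_{K,v}`, injectively (`FaithfulSMul`), ALGEBRAIC over `𝓞_{K,v}`, with maximal ideal lying over `v`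
(`𝓞_{K,v} → D` local).  Then there is a LOCAL ring homomorphism `f : D → R` over `𝓞_{K,v}`: `f ∘ (𝓞_{K,v} → D) = (𝓞_{K,v} → R)`
(★ `toClosureValuationSubring v`), `f(𝔪_D) ⊆ 𝔪_R` and `f⁻¹(Rˣ) = Dˣ`.  Construction: `f = ι ∘ γ ∘ ψ` with `ψ : D → K̄` over `𝓞_{K,v}`
(`IsAlgClosed.lift`), `V ⊇ ψ(D)` a valuation ring of `K̄` dominating `D` (Chevalley), `V = ℤ̄_𝔓` for its centre `𝔓 ∣ v`, `γ ∈ Γ_K` with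
`γ • 𝔓 = 𝔓₀` (transitivity), `ι : K̄ → \overline{K_v}` the tree's embedding with `ι⁻¹(R) = ℤ̄_{𝔓₀}`.  Use (road (b) of F0P5a's `stub_H`): with
`D = 𝒪_{𝒳,x̃}/q` from ★ `Literature.RingTheory.Flat.exists_prime_notMem_forall_eq_maximalIdeal`, `Spec f` is an `R`-point of `𝒳` over
`𝓞_{K,v}` whose closed point goes to `x̃` — the reduction map is surjective onto closed points ([Liu2002] Cor. 10.1.38).
[cite: NeukirchANT1999, Ch. II §8 (8.1)] [cite: Liu2002, Lemma 10.1.32 and Cor. 10.1.38] [cite: StacksProject, Tag 00IA] -/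
theorem exists_isLocalHom_comp_algebraMap_eq_toClosureValuationSubring :
    ∃ f : D →+* closureValuationSubring (v.adicCompletion K),
      IsLocalHom f ∧ f.comp (algebraMap (valuationSubringAtPrime K v) D) = toClosureValuationSubring v := by
  classical
  haveI := adicCompletionPrime_isMaximal K v
  -- (1) `ψ : D → K̄` over `𝓞_{K,v}`
  have hinjK : Function.Injective (algebraMap (valuationSubringAtPrime K v) (AlgebraicClosure K)) := by
    rw [IsScalarTower.algebraMap_eq (valuationSubringAtPrime K v) K (AlgebraicClosure K)]
    exact (algebraMap K (AlgebraicClosure K)).injective.comp (IsFractionRing.injective (valuationSubringAtPrime K v) K)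
  haveI : FaithfulSMul (valuationSubringAtPrime K v) (AlgebraicClosure K) :=
    (faithfulSMul_iff_algebraMap_injective _ _).2 hinjK
  let ψ : D →ₐ[valuationSubringAtPrime K v] AlgebraicClosure K := IsAlgClosed.lift
  -- (2) Chevalley: a valuation ring `V` of `K̄` dominating `ψ(D)`
  obtain ⟨V, hV, hloc⟩ := IsLocalRing.exists_factor_valuationRing ψ.toRingHom
  -- non-units of `D` go to non-units of `V`
  have hnu : ∀ x ∈ maximalIdeal D, ψ x ∈ V.nonunits := by
    intro x hx
    rw [ValuationSubring.mem_nonunits_iff_or]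
    by_contra h
    push Not at h
    have hu : IsUnit ((ψ.toRingHom.codRestrict V.toSubring hV) x) :=
      isUnit_iff_exists_inv.2 ⟨⟨(ψ x)⁻¹, h.2⟩, Subtype.ext (mul_inv_cancel₀ h.1)⟩
    exact (IsLocalRing.mem_maximalIdeal _).1 hx (IsLocalHom.map_nonunit x hu)
  -- elements of `v` go to non-units of `V`
  have hv : ∀ a ∈ v.asIdeal, ((algebraMap (𝓞 K) (absIntegers (𝓞 K) K) a : absIntegers (𝓞 K) K) : AlgebraicClosure K) ∈
      V.nonunits := by
    intro a ha
    have h1 : algebraMap (𝓞 K) (valuationSubringAtPrime K v) a ∈ maximalIdeal (valuationSubringAtPrime K v) :=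
      (IsLocalization.AtPrime.to_map_mem_maximal_iff (valuationSubringAtPrime K v) v.asIdeal a).2 ha
    have h2 : algebraMap (valuationSubringAtPrime K v) D (algebraMap (𝓞 K) (valuationSubringAtPrime K v) a) ∈ maximalIdeal D :=
      map_nonunit _ _ h1
    have h3 := hnu _ h2
    have h4 : ψ (algebraMap (valuationSubringAtPrime K v) D (algebraMap (𝓞 K) (valuationSubringAtPrime K v) a)) =
        algebraMap (𝓞 K) (AlgebraicClosure K) a := by
      rw [ψ.commutes, IsScalarTower.algebraMap_apply (𝓞 K) K (AlgebraicClosure K),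
        IsScalarTower.algebraMap_apply (valuationSubringAtPrime K v) K (AlgebraicClosure K),
        ← IsScalarTower.algebraMap_apply (𝓞 K) (valuationSubringAtPrime K v) K]
    rw [h4] at h3
    exact h3
  -- (2') the centre `𝔓` of `V` is a prime of `ℤ̄` above `v`, and `V = ℤ̄_𝔓`
  obtain ⟨ϖ, hϖv, hϖ0⟩ : ∃ ϖ : 𝓞 K, ϖ ∈ v.asIdeal ∧ ϖ ≠ 0 := Submodule.exists_mem_ne_zero_of_ne_bot v.ne_bot
  have hVtop : V ≠ ⊤ := by
    refine ne_top_of_mem_nonunits V ?_ (hv ϖ hϖv)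
    rw [Subalgebra.coe_algebraMap]  -- `((𝓞 K → ℤ̄) ϖ : K̄) = (𝓞 K → K̄) ϖ`
    have hinjOK : Function.Injective (algebraMap (𝓞 K) (AlgebraicClosure K)) := by
      rw [IsScalarTower.algebraMap_eq (𝓞 K) K (AlgebraicClosure K)]
      exact (algebraMap K (AlgebraicClosure K)).injective.comp (IsFractionRing.injective (𝓞 K) K)
    exact (map_ne_zero_iff _ hinjOK).2 hϖ0
  haveI h𝔓max : (absIntegersCentre V).IsMaximal := absIntegersCentre_isMaximal V hVtop
  have h𝔓v : absIntegersCentre V ∈ v.primesAbove := by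
    refine ⟨h𝔓max.isPrime, ⟨?_⟩⟩
    refine (Ideal.IsMaximal.eq_of_le v.isMaximal (Ideal.IsPrime.ne_top inferInstance) fun a ha => ?_)
    rw [Ideal.mem_comap, mem_absIntegersCentre_iff]
    exact hv a ha
  have hV𝔓 : V = absIntegersValuationSubring (absIntegersCentre V) :=
    eq_absIntegersValuationSubring_of_absIntegersCentre_eq V _ rfl
  -- (3) transitivity: `γ • 𝔓 = 𝔓₀`, so `γ • V = ℤ̄_{𝔓₀} = ι⁻¹(R)`
  obtain ⟨γ, hγ⟩ := HeightOneSpectrum.exists_smul_eq_of_mem_primesAbove_holds h𝔓v (adicCompletionPrime_mem_primesAbove K v)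
  have hγV : γ • V = absIntegersValuationSubring (adicCompletionPrime K v) :=
    eq_absIntegersValuationSubring_of_absIntegersCentre_eq _ _ (by rw [absIntegersCentre_smul, hγ])
  have hmemR : ∀ x : D, absClosureEmbedding K (v.adicCompletion K) (γ • ψ x) ∈ closureValuationSubring (v.adicCompletion K) := by
    intro x
    rw [absClosureEmbedding_mem_closureValuationSubring_adicCompletion_iff, ← hγV]
    exact ValuationSubring.smul_mem_pointwise_smul γ _ V (hV x)
  -- (4) `f = ι ∘ γ ∘ ψ : D → R`
  let g : D →+* AlgebraicClosure (v.adicCompletion K) :=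
    (absClosureEmbedding K (v.adicCompletion K)).toRingHom.comp
      ((show AlgebraicClosure K ≃ₐ[K] AlgebraicClosure K from γ).toRingHom.comp ψ.toRingHom)
  have hg : ∀ x, g x = absClosureEmbedding K (v.adicCompletion K) (γ • ψ x) := fun x => rfl
  let f : D →+* closureValuationSubring (v.adicCompletion K) :=
    g.codRestrict (closureValuationSubring (v.adicCompletion K)) fun x => (hg x).symm ▸ hmemR x
  have hf : ∀ x, ((f x : closureValuationSubring (v.adicCompletion K)) : AlgebraicClosure (v.adicCompletion K)) =
      absClosureEmbedding K (v.adicCompletion K) (γ • ψ x) := fun x => rfl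
  refine ⟨f, ⟨fun x hx => ?_⟩, ?_⟩
  · -- `f` is local: a non-unit `x` goes to a non-unit of `R`
    by_contra hxu
    have hx𝔪 : x ∈ maximalIdeal D := hxu
    -- `γ • ψ x` is a non-unit of `γ • V = ℤ̄_{𝔓₀}`
    have h1 : γ • ψ x ∈ (absIntegersValuationSubring (adicCompletionPrime K v)).nonunits := by
      rw [← hγV, smul_mem_nonunits_pointwise_smul_iff]
      exact hnu x hx𝔪
    have hmem : γ • ψ x ∈ absIntegersValuationSubring (adicCompletionPrime K v) :=
      hγV ▸ ValuationSubring.smul_mem_pointwise_smul γ _ V (hV x)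
    have h2 : (⟨γ • ψ x, hmem⟩ : absIntegersValuationSubring (adicCompletionPrime K v)) ∈
        maximalIdeal (absIntegersValuationSubring (adicCompletionPrime K v)) :=
      ValuationSubring.coe_mem_nonunits_iff.1 h1
    -- `ι|_{ℤ̄_{𝔓₀}}` is local, so `f x` is a non-unit of `R`
    haveI := isLocalHom_restrict_absClosureEmbedding_adicCompletion K v
    have h3 := map_nonunit ((absClosureEmbedding K (v.adicCompletion K)).toRingHom.restrict
        (absIntegersValuationSubring (adicCompletionPrime K v)) (closureValuationSubring (v.adicCompletion K))
        (forall_absClosureEmbedding_mem_closureValuationSubring_adicCompletion K v)) _ h2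
    have h4 : (absClosureEmbedding K (v.adicCompletion K)).toRingHom.restrict
        (absIntegersValuationSubring (adicCompletionPrime K v)) (closureValuationSubring (v.adicCompletion K))
        (forall_absClosureEmbedding_mem_closureValuationSubring_adicCompletion K v) ⟨γ • ψ x, hmem⟩ = f x :=
      Subtype.ext (hf x).symm
    rw [h4] at h3
    exact (IsLocalRing.mem_maximalIdeal _).1 h3 hx
  · -- `f` extends `𝓞_{K,v} → R`
    ext a
    change ((f (algebraMap (valuationSubringAtPrime K v) D a) : closureValuationSubring (v.adicCompletion K)) :
        AlgebraicClosure (v.adicCompletion K)) = ((toClosureValuationSubring v a : closureValuationSubring (v.adicCompletion K)) :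
        AlgebraicClosure (v.adicCompletion K))
    rw [hf, ψ.commutes, IsScalarTower.algebraMap_apply (valuationSubringAtPrime K v) K (AlgebraicClosure K),
      smul_algebraMap, AlgHom.commutes,
      show ((toClosureValuationSubring v a : closureValuationSubring (v.adicCompletion K)) : AlgebraicClosure (v.adicCompletion K)) =
          algebraMap K (AlgebraicClosure (v.adicCompletion K)) (algebraMap (valuationSubringAtPrime K v) K a) from
        congrArg (fun h : valuationSubringAtPrime K v →+* AlgebraicClosure (v.adicCompletion K) => h a)
          (algebraMap_comp_toClosureValuationSubring v)]

end Main

end Literature.NumberTheory.GaloisRepresentations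

end
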